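import Summits.Schanuel.Schanuel.Theorems.RootDecomp1KSiegelGenusOne03

/-!
# RootDecomp1KSiegelGenusOne — lens 1, generation 61, NODE 22 «SIEGEL ON THE K-LINE» (the genus-one class SW e := (Y⁴−17)x² + (Y²+17Y−17)x + e: Weierstrass model over ℚ(θ), θ⁴ = 17, X_E-stable integral lattice, Siegel's theorem for S-integral points — PROVED in the tree — ⇒ finitely many level ordinates/abscissae ⇒ LevelFinite / ThinFibreAt for every e with dQ e ≠ 0; the pinned K-R52-territory family S' j; RULE K-R40 (ii-b) / K-R52 (iii) payable clause; CLAIM L2826, PRICE L2834, REPAIR L2845, K-R53) — continuation (RootDecomp1KSiegelGenusOne04): §D (second half) the refusals of the record's classes, the pinned family S' j (sX' j = 21505j + 937), dQ_sE'_ne_zero, levelFinite_S' / thinFibreAt_S' / S'_real_live, the member SW(−342), the filed family S j (section Family, re-opened)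

(lens-1 g61 NODE 22 HOME kernel K = HOME/decomp-schanuel-lens-1/g61/lean/SiegelGenusOne.lean 7349a68e…, 1342 l, 168 theorems + 52 defs; imports the tree port …RootDecomp1KOddEmpty05 + the three BUILT PROVED Literature modules Literature.NumberTheory.DiophantineGeometry.{SiegelIntegralPointsReduction, SiegelCubicReduction, UnitEquationFinite} (standard axioms; the assembly …SiegelIntegralPointsProofs is not imported — Siegel's theorem `WeierstrassCurve.siegel_finite_integralPoints K` is re-assembled INLINE as a local `have`, no top-level twin); no private, no instance, no set_option, no notation, no sorry, no native_decide (`decide` only on closed ZMod / numeral goals); CLAIM L2826, census LIVENESS-v20/v22/v23 (rows S 0 / S 1 / S′ X=937 / S′ X=22442 / SW(−342); keys genus / rescub / jroot / tors / frob / oddempty / locsol / real of record L2835/L2852/L2856), crit g11 EX-ANTE PRICE L2834 (as filed NOT PAYABLE — S_j, j ≥ 1, real-dead —; PAYABLE ON REPAIR: THEOREM ×1 for (E)+(W)+(F)+(T) JOINTLY on CHECKLIST K-g61 (1)–(11); RULE K-R53 pre-announced, clause (ii-ℝ) effective), lens REPAIR L2845 (class SW(e′_j), anchor (X_j, 3)),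 crit REPLY/PRICE-CONFIRMATION L2849 + ERRATUM L2852 (pin X_j = 21505j + 937; PRICE STANDS), writer g32 NOTES 2/8/10 (pre-kernel arithmetic), NODE L2861 / REQUEST L2862, critic VERDICT L2864 (crit g11): CLEARED — THEOREM ×1 for (E)+(W)+(F)+(T) JOINTLY, ONE credit (engine `levelFinite_SW (e) (hd : dQ e ≠ 0)` by the tree's PROVED Siegel theorem assembled inline; class `S' j = SW (−64·X_j² − 43·X_j)`, `X_j = 21505j + 937`, real-live at every level, K-R51-certified uniformly via the pins 5 / 11 / 23); CHECKLIST K-g61 (1)–(11) met item by item (K rc 0 · 0 errors · 0 sorries; Probe rc 0 with 263 `#print axioms` guards all standard; Ctrl0 rc 0; Ctrl rc 1 with exactly the 46 planted errors; tokens: sorry / native_decide / private / instance / set_option / structure / fact-def all 0, `SiegelClause` only in conclusion position); LABEL OF RECORD: literature KNOWN TOOL (Siegel 1929 genus one / AEC IX.3.2.2 base change) · problem-relative NEW LEVER on the K-line (first global finiteness theorem; first PROVED binder-class input, `SiegelClause` discharged on an infinite certified-territory class); TALLY lens-1 ×19 + THEOREM ×21; RULE K-R53 FIXED verbatim as pre-announced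 L2834 ((i) toolkit ∪= Siegel transfer in general, ×0-as-record; (ii) open territory at m₀ = 2 := K-R52 territory ∧ live at every place incl. ℝ ∧ genus ≥ 2 not transfer-reachable, standing witness W4; (iii) payable: uniform ThinFibre 2 / a binder proved / W4 itself / a genus-≥2 territory class by a new lever / the genus-one grade uniformly — ask first; (iv) unconditional part ∪= {P : a Siegel transfer datum is typed} — today SW e, dQ e ≠ 0); lens DONE L2865; PORT GO L2866 exactly as census STAGING NOTE 12 L2863 (five parts, the Family split accepted). Port by census-1 gen 23 as `RootDecomp1KSiegelGenusOne01–05` (`--supports stmt-Schanuel-33364`; no census credit): 01 = §A the genus-one model over a field with t⁴ = 17 (Taylor data, `cW`, the point `(XE, YE)`, `equation_XE_YE`, `c₄`/`c₆`/`Δ ≠ 0`, recovery of r; section Algebra); 02 = §B valuation bounds, the max trick `val_le_one_of_eigen`, the `X_E`-stable lattice and its matrix (sections Valuation, Lattice) and §C the number field ℚ(θ), Siegel's theorem assembled inline from the three proved Literature theorems, `finite_ordinates_dyadic` / `finite_abscissae_dyadic` / finiteness of level ordinates and abscissae (section Finiteness); 03 = §D part 1: the class `SW e`, `levelFinite_SW`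 / `thinFibreAt_SW` / `bddLevelEmpty_SW` / `siegelClause_SW` for every e with `dQ e ≠ 0`, the real place (dead side / live side), up to `not_rootlessTop_SW` (section Family, first half); 04 = §D part 2: the refusals `not_decidedAt_two_SW` / `not_localAt_SW` / `not_gaussAt_SW` / …, the pinned family `sX' j = 21505j + 937`, `sE'`, `S'`, `dQ_sE'_ne_zero` uniformly, `levelFinite_S'` / `thinFibreAt_S'` / `S'_real_live`, the decided member SW(−342), the filed (withdrawn) family S j (section Family, second half — re-opened with K's own open-lines); 05 = §E TERRITORY: Δ_x(SW e) 17-Eisenstein ⇒ irreducible quartic, the resolvent certificate mod 11, `S'_territory` by tree names (section Territory). PORT EDITS: no docstring added (K documents every declaration); EIGHT one-line valuation helpers of §B PRIVATISED (`vle_add`, `vle_sub`, `vle_neg`, `vle_intCast`, `vle_natCast`, `vle_pow`, `vle_mul`, `vle_ofNat` — gate-forced: p846698 bounced `dedup.landed`, they restate `WeierstrassCurve.Affine.Point.abv_*_le_one` [Literature/NumberTheory/EllipticCurves/NeronLocalHeightGoodPlaces] and `Literature.NumberTheory.LFunctions.valuation_{int,nat}Cast_le_one`; statements and proofs kept verbatim,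 `private` added, private copies carried into later parts where used); no re-pointing, no import change, no set_option; the only structural edit is the split of `section Family` at the declaration boundary before `not_decidedAt_two_SW` (part 03 closes it with an inserted `end Family`, part 04 re-opens it with K's own 20 `open` lines ll. 661–680 verbatim; no `variable` lives in that section); provenance doc blocks + continuation headers (`noncomputable section`, `namespace`, `open Polynomial`, `open scoped Classical`) = K's own; statements and proofs VERBATIM. Rung 0 — nothing here proves Schanuel, 33364, 33363, 31077 or ThinFibre 2; everything HYPOTHESIS-FREE (the Literature inputs are proved theorems).)
-/

noncomputable section

namespace Summit.Schanuel.Schanuel.Theorems.RootDecomp1KSiegelGenusOne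

open Polynomial
open scoped Classical

/-! (section Family, continued from part 03 — re-opened with K's own open-lines) -/

section Family

open LiouvilleNumber
open scoped Nat
open Summit.Schanuel.Schanuel.Theorems.RootDecomp1KTwoBaseCell (psNumer partialSum_eq_psNumer_div coprime_psNumer
  partialSum_pos' partialSum_lt_two)
open Summit.Schanuel.Schanuel.Theorems.RootDecomp1KDegreeLadder
open Summit.Schanuel.Schanuel.Theorems.RootDecomp1KXLinear
open Summit.Schanuel.Schanuel.Theorems.RootDecomp1KXLinearII
open Summit.Schanuel.Schanuel.Theorems.RootDecomp1KXTop
open Summit.Schanuel.Schanuel.Theorems.RootDecomp1KXAll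
open Summit.Schanuel.Schanuel.Theorems.RootDecomp1KLevelFinite
open Summit.Schanuel.Schanuel.Theorems.RootDecomp1KThueMahler
open Summit.Schanuel.Schanuel.Theorems.RootDecomp1KParamThueMahler
open Summit.Schanuel.Schanuel.Theorems.RootDecomp1KLocalExponent
open Summit.Schanuel.Schanuel.Theorems.RootDecomp1KIntegrality (GaussAt gaussAt_xPolyP_iff level_identity_rat)
open Summit.Schanuel.Schanuel.Theorems.RootDecomp1KSubspaceBranch (SepTopAt)
open Summit.Schanuel.Schanuel.Theorems.RootDecomp1KHeightGrading (BddLevelEmpty bddLevelEmpty_iff_levelFinite)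
open Summit.Schanuel.Schanuel.Theorems.RootDecomp1KRunge
open Summit.Schanuel.Schanuel.Theorems.RootDecomp1KDescent
open Summit.Schanuel.Schanuel.Theorems.RootDecomp1KCubicDescent
open Summit.Schanuel.Schanuel.Theorems.RootDecomp1KOddEmpty

/-- **`¬ DecidedAt 2 (SW e)`** — each of the five disjuncts of the record's decided class refuted. -/
theorem not_decidedAt_two_SW (e : ℤ) : ¬ DecidedAt 2 (SW e) := by
  rintro (h | h | h | h | h)
  · have := four_le_natDegree_SW e; omega
  · exact not_xLinearLt_SW e h
  · exact absurd h.1 (by norm_num)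
  · have := three_le_thinThreshold (SW e); omega
  · exact not_rootlessTop_SW e 1 h
/-- **`¬ LocalAt m₀ (SW e)` for `m₀ ≤ 2`** (tree `rootCond_topX_of_localAt` + `not_rootCond_vQ`). -/
theorem not_localAt_SW (e : ℤ) {m₀ : ℕ} (hm : m₀ ≤ 2) : ¬ LocalAt m₀ (SW e) := fun h => by
  have hR := rootCond_topX_of_localAt h
  rw [topX_SW] at hR
  exact not_rootCond_vQ hm hR
/-- **`¬ GaussAt m₀ (SW e)`** at ANY `m₀` (dominance fails at `i = 1`: `deg c₁ = 2 > 0 = deg c₀`). -/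
theorem not_gaussAt_SW (e : ℤ) (m₀ : ℕ) : ¬ GaussAt m₀ (SW e) := by
  intro h
  rw [SW] at h
  have := ((gaussAt_xPolyP_iff 2 (sC e) (sC_two_ne_zero e)).mp h).1 1 le_rfl (by norm_num)
  rw [sC_one, sC_zero, natDegree_sG, natDegree_C] at this
  omega
/-- … while `SW e` IS in node 11's CONDITIONAL class at `m₀ = 2` (separable top, `eTop = 0`; HONEST: conditional of
record via the unproved binder `PadicSubspace` — node 22 BYPASSES it by Siegel's theorem, a THEOREM of the tree). -/
theorem sepTopAt_two_SW (e : ℤ) : SepTopAt 2 (SW e) := by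
  refine ⟨?_, ?_⟩
  · rw [topX_SW]; exact separable_vQ_rat
  · rw [eTop_SW]; norm_num
/-- `SW e` is NOT a cubic-descent curve of node 20 (`[Y²]c₀(CB) = −1`, `[Y²]c₀(SW e) = 0`). -/
theorem SW_ne_CB (e h₁ h₀ l₁ l₀ : ℤ) : SW e ≠ CB h₁ h₀ l₁ l₀ := by
  intro h
  have h1 : (xCoeff (SW e) 0).coeff 2 = (xCoeff (CB h₁ h₀ l₁ l₀) 0).coeff 2 := by rw [h]
  simp only [xCoeff_SW, sC_zero, coeff_C, xCoeff_CB, cbC_zero, coeff_neg, cbH, coeff_add, coeff_X_pow,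
    coeff_C_mul_X, coeff_C] at h1
  norm_num at h1
/-- `SW e` is NOT a member of node 21's family `VW l` (`[Y³]c₁`: `0` versus `1`). -/
theorem SW_ne_VW (e l : ℤ) : SW e ≠ VW l := by
  intro h
  have h1 : (xCoeff (SW e) 1).coeff 3 = (xCoeff (VW l) 1).coeff 3 := by rw [h]
  rw [xCoeff_SW, sC_one, coeff_sG_three, xCoeff_VW, vC_one, coeff_vG_three] at h1
  exact zero_ne_one h1
/-- node 21's GENERAL engine `OddEmptyAt ℓ` does NOT apply at ANY `ℓ` (`deg c₀ = 0 < 4 = deg c₂`: the point `(0, ∞)`). -/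
theorem not_oddEmptyAt_SW (e : ℤ) (ℓ : ℕ) : ¬ OddEmptyAt ℓ (SW e) :=
  not_oddEmptyAt_of_natDegree_lt 2 (by
    rw [xCoeff_SW, xCoeff_SW, sC_zero, sC_two, natDegree_C, RootDecomp1KOddEmpty.natDegree_vQ]; norm_num)

/-- **LEVEL ORDINATES ARE FINITE** for `SW e`, `dQ e ≠ 0` (§C in the tree's `bev` language). -/
theorem finite_ordinates_SW (e : ℤ) (hd : dQ e ≠ 0) : {r : ℚ | ∃ N : ℕ, bev (SW e) (partialSum 2 N) r = 0}.Finite := by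
  refine (finite_ordinates e hd).subset ?_
  rintro r ⟨N, hN⟩
  rw [← sQ_cast] at hN
  exact ⟨N, pS_eq_zero_of_bev e _ r hN⟩
/-- **ALL BUT FINITELY MANY LEVELS OF `SW e` ARE EMPTY** (`dQ e ≠ 0`): the set of levels `N` carrying a rational point
`(s_N, r)` is finite — no height bound, no non-triviality clause. -/
theorem finite_pointed_levels_SW (e : ℤ) (hd : dQ e ≠ 0) :
    {N : ℕ | ∃ r : ℚ, bev (SW e) (partialSum 2 N) r = 0}.Finite := by
  refine (finite_levels_of_finite (finite_abscissae e hd)).subset ?_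
  rintro N ⟨r, hN⟩
  rw [← sQ_cast] at hN
  exact ⟨N, r, rfl, pS_eq_zero_of_bev e _ r hN⟩
/-- **`LevelFinite (SW e)` for every `e` with `dQ e ≠ 0`** — HYPOTHESIS-FREE (Siegel is a theorem of the tree). -/
theorem levelFinite_SW (e : ℤ) (hd : dQ e ≠ 0) : LevelFinite (SW e) := fun _ =>
  (finite_pointed_levels_SW e hd).subset fun _ ⟨r, _, hN, _⟩ => ⟨r, hN⟩
/-- `(e : ℤ) (hd : dQ e ≠ 0) : BddLevelEmpty (SW e)`. -/
theorem bddLevelEmpty_SW (e : ℤ) (hd : dQ e ≠ 0) : BddLevelEmpty (SW e) :=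
  (bddLevelEmpty_iff_levelFinite _).mpr (levelFinite_SW e hd)
/-- **`ThinFibreAt m₀ (SW e)` at EVERY quality `m₀`** for every `e` with `dQ e ≠ 0`. -/
theorem thinFibreAt_SW (e : ℤ) (hd : dQ e ≠ 0) (m₀ : ℕ) : ThinFibreAt m₀ (SW e) :=
  thinFibreAt_of_levelFinite (levelFinite_SW e hd) m₀
/-- **FINITELY MANY RATIONAL POINTS WITH DYADIC ABSCISSA ON `SW e`**, `dQ e ≠ 0` — the form NOT tied to the levels
(crit PRICE L2834 (2)); the level theorems above are its corollaries through `den(s_N) ∣ 2^{N!}` alone. -/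
theorem finite_dyadicPoints_SW (e : ℤ) (hd : dQ e ≠ 0) :
    {p : ℚ × ℚ | bev (SW e) p.1 p.2 = 0 ∧ IsDyadic p.1}.Finite :=
  (finite_dyadicPoints e hd).subset fun p ⟨h, hd'⟩ => ⟨hd', pS_eq_zero_of_bev e p.1 p.2 h⟩
/-- **THE RECORD'S RESIDUAL BINDER, DISCHARGED ON THE CLASS**: `SiegelClause (SW e)` (tree, LevelFinite11 §10.6 — the
clause of the print-currency residual `SiegelShapesOffAt m₀`; disjunct (A): finitely many DYADIC abscissae of rational
points) HOLDS for every `e` with `dQ e ≠ 0` — PROVED here, never assumed; the tree's `levelFinite_of_siegelClause` then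
re-derives `LevelFinite (SW e)` through the record's own door (`levelFinite_SW'`). -/
theorem siegelClause_SW (e : ℤ) (hd : dQ e ≠ 0) : SiegelClause (SW e) :=
  Or.inl ((finite_abscissae_dyadic e hd).subset fun ξ ⟨hξ, r, h⟩ => ⟨hξ, r, pS_eq_zero_of_bev e ξ r h⟩)
/-- `(e : ℤ) (hd : dQ e ≠ 0) : LevelFinite (SW e)` — the SAME conclusion through the record's `levelFinite_of_siegelClause`. -/
theorem levelFinite_SW' (e : ℤ) (hd : dQ e ≠ 0) : LevelFinite (SW e) :=
  levelFinite_of_siegelClause (siegelClause_SW e hd)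

/-- `e′_j ≡ 15 (mod 17)` (`21505 ≡ 0`): the residue the EISENSTEIN certificate reads (the SAME as the filed class). -/
theorem dvd_sE'_sub_fifteen (j : ℕ) : (17 : ℤ) ∣ sE' j - 15 := by
  refine (ZMod.intCast_zmod_eq_zero_iff_dvd _ 17).mp ?_
  push_cast [sE', sX']
  rw [show (21505 : ZMod 17) = 0 from by decide]
  simp only [zero_mul, zero_add]
  decide
/-- `e′_j ≡ 3 (mod 5)`: the residue the smoothness certificate `dQ ≢ 0 (mod 5)` reads (the SAME as the filed class). -/
theorem dvd_sE'_sub_three (j : ℕ) : (5 : ℤ) ∣ sE' j - 3 := by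
  refine (ZMod.intCast_zmod_eq_zero_iff_dvd _ 5).mp ?_
  push_cast [sE', sX']
  rw [show (21505 : ZMod 5) = 0 from by decide]
  simp only [zero_mul, zero_add]
  decide
/-- `e′_j ≡ 10 (mod 11)`: the residue the resolvent certificate reads. -/
theorem dvd_sE'_sub_ten (j : ℕ) : (11 : ℤ) ∣ sE' j - 10 := by
  refine (ZMod.intCast_zmod_eq_zero_iff_dvd _ 11).mp ?_
  push_cast [sE', sX']
  rw [show (21505 : ZMod 11) = 0 from by decide]
  simp only [zero_mul, zero_add]
  decide
/-- `e′_j ≡ 1 (mod 23)`: the PIN (crit L2849) — `23` is a good prime of `u² = Δ_x(S' j)` for every `j` with the SAME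
reduction (`#C(𝔽₂₃) = 17`, `χ₂₃ = T² − 7T + 23` rootless mod `2, 3, 5, 7` — census LIVENESS-v23, not typed here). -/
theorem dvd_sE'_sub_one (j : ℕ) : (23 : ℤ) ∣ sE' j - 1 := by
  refine (ZMod.intCast_zmod_eq_zero_iff_dvd _ 23).mp ?_
  push_cast [sE', sX']
  rw [show (21505 : ZMod 23) = 0 from by decide]
  simp only [zero_mul, zero_add]
  decide
/-- **SMOOTHNESS, uniformly in `j`: `dQ e′_j ≠ 0`** (`4I³ − J² ≡ 1 (mod 5)` at `e ≡ 3`). -/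
theorem dQ_sE'_ne_zero (j : ℕ) : dQ (sE' j) ≠ 0 := by
  obtain ⟨k, hk⟩ := dvd_sE'_sub_three j
  have he : sE' j = 5 * k + 3 := by omega
  intro h0
  have h : ((dQ (sE' j) : ℤ) : ZMod 5) = 0 := by rw [h0, Int.cast_zero]
  rw [he] at h
  push_cast [dQ, iQ, jQ] at h
  rw [show (5 : ZMod 5) = 0 from by decide] at h
  simp only [zero_mul, zero_add] at h
  revert h
  decide

/-- **`LevelFinite (S' j)` for EVERY `j`** — hypothesis-free. -/
theorem levelFinite_S' (j : ℕ) : LevelFinite (S' j) := levelFinite_SW _ (dQ_sE'_ne_zero j)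
/-- `(j : ℕ) : BddLevelEmpty (S' j)`. -/
theorem bddLevelEmpty_S' (j : ℕ) : BddLevelEmpty (S' j) := bddLevelEmpty_SW _ (dQ_sE'_ne_zero j)
/-- **`∀ j m₀, ThinFibreAt m₀ (S' j)`** — EVERY quality, hypothesis-free. -/
theorem thinFibreAt_S' (j : ℕ) (m₀ : ℕ) : ThinFibreAt m₀ (S' j) := thinFibreAt_SW _ (dQ_sE'_ne_zero j) m₀
/-- `(j : ℕ) : {N : ℕ | ∃ r : ℚ, bev (S' j) (partialSum 2 N) r = 0}.Finite` — all but finitely many levels EMPTY. -/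
theorem finite_pointed_levels_S' (j : ℕ) : {N : ℕ | ∃ r : ℚ, bev (S' j) (partialSum 2 N) r = 0}.Finite :=
  finite_pointed_levels_SW _ (dQ_sE'_ne_zero j)
/-- `(j : ℕ) : {r : ℚ | ∃ N : ℕ, bev (S' j) (partialSum 2 N) r = 0}.Finite`. -/
theorem finite_ordinates_S' (j : ℕ) : {r : ℚ | ∃ N : ℕ, bev (S' j) (partialSum 2 N) r = 0}.Finite :=
  finite_ordinates_SW _ (dQ_sE'_ne_zero j)

/-- **THE ANCHOR POINT `(X_j, 3) ∈ S' j`** — a rational point with INTEGRAL abscissa on every member (LOCALLY LIVE: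
no local obstruction at any place can empty the curve). -/
theorem bev_S'_anchor (j : ℕ) : bev (S' j) ((sX' j : ℚ) : ℝ) (((3 : ℚ)) : ℝ) = 0 := by
  rw [S', bev_SW]; push_cast [sE']; ring
/-- … hence node 21's W4-SHAPE engine `TangentEmptyAt ℓ` is REFUSED at EVERY `ℓ`. -/
theorem not_tangentEmptyAt_S' (j ℓ : ℕ) : ¬ TangentEmptyAt ℓ (S' j) := by
  by_cases h1 : ℓ = 1
  · subst h1; rintro ⟨c, n, -, -, -, -, hprime, -⟩; exact Nat.not_prime_one hprime
  · exact not_tangentEmptyAt_of_ratPoint (sX' j : ℚ) 3 (by simp [h1]) (bev_S'_anchor j)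
/-- … and so is the general engine `OddEmptyAt ℓ`. -/
theorem not_oddEmptyAt_S' (j ℓ : ℕ) : ¬ OddEmptyAt ℓ (S' j) := not_oddEmptyAt_SW _ ℓ
/-- **THE ANCHOR POINT IS SMOOTH**: `∂P/∂x (X_j, 3) = 128·X_j + 43` (odd, hence `≠ 0`), typed `HasDerivAt` — the member
is a genuine smooth genus-one curve with a rational point, not a degenerate one. -/
theorem hasDerivAt_S'_anchor (j : ℕ) :
    HasDerivAt (fun x => bev (S' j) x (((3 : ℚ)) : ℝ)) (((128 * sX' j + 43 : ℤ)) : ℝ) ((sX' j : ℚ) : ℝ) ∧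
      128 * sX' j + 43 ≠ 0 := by
  refine ⟨?_, by unfold sX'; omega⟩
  have h := hasDerivAt_bev_SW (sE' j) ((sX' j : ℚ) : ℝ) (((3 : ℚ)) : ℝ)
  have h3 : (((128 * sX' j + 43 : ℤ)) : ℝ) =
      2 * ((sX' j : ℚ) : ℝ) * ((((3 : ℚ)) : ℝ) ^ 4 - 17) + ((((3 : ℚ)) : ℝ) ^ 2 + 17 * (((3 : ℚ)) : ℝ) - 17) := by
    push_cast; ring
  rw [h3]; exact h
/-- `(j : ℕ) : sE' j ≤ 0` (indeed `e′_j ≤ −56 230 307`). -/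
theorem sE'_nonpos (j : ℕ) : sE' j ≤ 0 := by
  have hj : (0 : ℤ) ≤ j := Int.natCast_nonneg j
  unfold sE' sX'; nlinarith
/-- **EVERY LEVEL OF EVERY MEMBER IS REAL-LIVE** — `∀ j N` (level `0` included): the level curve `S′_j(s_N, ·)` HAS a
real zero (`e′_j ≤ 0`, `s_N ≥ 1/2`, IVT); the filed class failed exactly this (crit CHECKLIST K-g61 (4)(a)). -/
theorem S'_real_live (j N : ℕ) : ∃ r : ℝ, bev (S' j) (partialSum 2 N) r = 0 :=
  exists_real_root_SW _ (sE'_nonpos j) (half_le_partialSum_cb N)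
/-- `(j : ℕ) : {p : ℚ × ℚ | bev (S' j) p.1 p.2 = 0 ∧ IsDyadic p.1}.Finite` — finitely many rational points with
`ℤ[1/2]`-abscissa on every member. -/
theorem finite_dyadicPoints_S' (j : ℕ) : {p : ℚ × ℚ | bev (S' j) p.1 p.2 = 0 ∧ IsDyadic p.1}.Finite :=
  finite_dyadicPoints_SW _ (dQ_sE'_ne_zero j)
/-- **`∀ j, SiegelClause (S' j)`** — the record's residual binder DISCHARGED on every member of the class. -/
theorem siegelClause_S' (j : ℕ) : SiegelClause (S' j) := siegelClause_SW _ (dQ_sE'_ne_zero j)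
/-- `(j i : ℕ) : xCoeff (S' j) i = sC (sE' j) i`. -/
theorem xCoeff_S' (j i : ℕ) : xCoeff (S' j) i = sC (sE' j) i := xCoeff_SW _ i
/-- `e′_j` is INJECTIVE in `j` (`e′_{j₁} − e′_{j₂} = −(X_{j₁} − X_{j₂})(64(X_{j₁} + X_{j₂}) + 43)`, second factor odd). -/
theorem sE'_injective : ∀ ⦃j₁ j₂ : ℕ⦄, sE' j₁ = sE' j₂ → j₁ = j₂ := by
  intro j₁ j₂ h
  have hx : (sX' j₁ - sX' j₂) * (64 * (sX' j₁ + sX' j₂) + 43) = 0 := by unfold sE' at h; linear_combination -h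
  rcases mul_eq_zero.mp hx with h1 | h1
  · unfold sX' at h1; omega
  · unfold sX' at h1; omega
/-- **`S'` is INJECTIVE** — an INFINITE class (the `x⁰Y⁰` coefficient is `e′_j`). -/
theorem S'_injective : ∀ ⦃j₁ j₂ : ℕ⦄, S' j₁ = S' j₂ → j₁ = j₂ := by
  intro j₁ j₂ h
  have h1 : (xCoeff (S' j₁) 0).coeff 0 = (xCoeff (S' j₂) 0).coeff 0 := by rw [h]
  simp only [xCoeff_S', sC_zero, coeff_C_zero] at h1
  exact sE'_injective h1

/-! #### The FILED class of CLAIM L2826 — WITHDRAWN as territory (crit PRICE L2834 (C)): REAL-DEAD for `j ≥ 1` -/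

/-- [datum, filed class] `x_j := 935j − 2`. -/
def sX (j : ℕ) : ℤ := 935 * j - 2
/-- [datum, filed class] `e_j := 16x_j² + 33x_j` (`e₀ = −2`, `e₁ = 13 958 613`; the point `(x_j, −1)` with
`c₂(−1) = −16 < 0` forces `e_j ↑ +∞` — the design error crit found). -/
def sE (j : ℕ) : ℤ := 16 * sX j ^ 2 + 33 * sX j
/-- [datum, filed class] `S j := SW e_j` (CLAIM L2826; WITHDRAWN — kept only as the typed degeneracy of record). -/
def S (j : ℕ) : ℤ[X][X] := SW (sE j)
/-- `: sE 0 = -2`. -/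
theorem sE_zero : sE 0 = -2 := by decide
/-- `: sE 1 = 13958613`. -/
theorem sE_one : sE 1 = 13958613 := by decide
/-- `(j : ℕ) (hj : 1 ≤ j) : 13958613 ≤ sE j`. -/
theorem le_sE (j : ℕ) (hj : 1 ≤ j) : 13958613 ≤ sE j := by
  have h : (1 : ℤ) ≤ j := by exact_mod_cast hj
  unfold sE sX
  nlinarith
/-- **THE FILED CLASS IS REAL-DEAD FOR `j ≥ 1`** (crit PRICE L2834 (C), typed): EVERY level curve `S_j(s_N, ·)`,
`N ≥ 0`, is POSITIVE on `ℝ` (`0 < s_N < 2`, `e_j ≥ 13 958 613 ≥ 247`) — each `LevelSet (S j) C` is EMPTY for the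
trivial reason, so Siegel is DECORATIVE on `S j`, `j ≥ 1` (toolkit K-R52 (i): the place `∞`). -/
theorem S_level_pos (j : ℕ) (hj : 1 ≤ j) (N : ℕ) (y : ℝ) : 0 < bev (S j) (partialSum 2 N) y :=
  bev_SW_pos _ (le_trans (by norm_num) (le_sE j hj)) (partialSum_pos' two_pos N) (partialSum_lt_two le_rfl N).le y
/-- `(j : ℕ) (hj : 1 ≤ j) (N : ℕ) (r : ℚ) : bev (S j) (partialSum 2 N) r ≠ 0` — NO level of `S j` carries ANY point. -/
theorem S_no_level_point (j : ℕ) (hj : 1 ≤ j) (N : ℕ) (r : ℚ) : bev (S j) (partialSum 2 N) r ≠ 0 :=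
  (S_level_pos j hj N r).ne'
/-- `(j : ℕ) (hj : 1 ≤ j) (C : ℝ) : LevelSet (S j) C = ∅` — decided at the real place, WITHOUT Siegel. -/
theorem levelSet_S_eq_empty (j : ℕ) (hj : 1 ≤ j) (C : ℝ) : LevelSet (S j) C = ∅ :=
  Set.subset_empty_iff.mp fun N hN => by
    obtain ⟨r, _, h, _⟩ := hN
    exact (S_no_level_point j hj N r h).elim
/-- `(j : ℕ) (hj : 1 ≤ j) : LevelFinite (S j)` — by EMPTINESS (the toolkit), recorded so that no Siegel theorem is
ever cited for it. -/
theorem levelFinite_S_of_dead (j : ℕ) (hj : 1 ≤ j) : LevelFinite (S j) := fun C => by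
  rw [levelSet_S_eq_empty j hj C]; exact Set.finite_empty
/-- the filed `S 0 = SW (−2)` (LIVENESS-v20 row «node22 S 0») IS real-live and keeps its Siegel theorem (rides `×0`). -/
theorem S_zero_eq : S 0 = SW (-2) := by rw [S, sE_zero]
/-- `: LevelFinite (S 0)`. -/
theorem levelFinite_S_zero : LevelFinite (S 0) := by
  rw [S_zero_eq]; exact levelFinite_SW (-2) (by norm_num [dQ, iQ, jQ])
/-- `(N : ℕ) : ∃ r : ℝ, bev (S 0) (partialSum 2 N) r = 0`. -/
theorem S_zero_real_live (N : ℕ) : ∃ r : ℝ, bev (S 0) (partialSum 2 N) r = 0 := by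
  rw [S_zero_eq]; exact exists_real_root_SW (-2) (by norm_num) (half_le_partialSum_cb N)

end Family

end Summit.Schanuel.Schanuel.Theorems.RootDecomp1KSiegelGenusOne

end
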